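import Summits.QuantumFields.YangMills.Theorems.BalabanUVNodesN15KingModelPotentialDressedTower
import Literature.MathematicalPhysics.QuantumFieldTheory.Balaban1983to89.Beta.PlaquetteHessian

/-!
# Route «BalabanUVNodes» (K4 «SpineRates»), node N15 = NE2 — THE KING-MODEL RUNG, part 9g: THE DRESSED EFFECTIVE LAPLACIAN IS MONOTONE IN THE
# POTENTIAL — `w ≤ w′ ⇒ Δ_eff(w) ≤ Δ_eff(w′)` as quadratic forms; a NONNEGATIVE potential tower of ANY size keeps King's coercivity `γ₀` (no window)

Cell `pub-ymgap`, Track A (D-0062), seat `pub-ymgap-dag-n15-d` (R134 seat, strategy s3, gen 7).  `bears_on: R4∕N15`; `--supports` the K3‴ item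
`SpineGivenEndpointR13` (stmt-QuantumFields-19912).  COUNT-NEUTRAL; 0 `def`.  Imports part 9c (`kingTowerPot`, `fineOpPot_coercive_of_ge`, `fineOpPot_symm`) and `Lit/…/Beta/PlaquetteHessian` (one symmetric-form lemma, by name).

WHAT THIS FILE PROVES (kernel).  Parts 9c∕9d bought coercivity of the fully dressed tower `Δ^{(k)}_v + aL⁻²Q*Q ≥ γ₀ − c_E·V` by treating `Δ_v − Δ` as
a local perturbation — a SMALLNESS window in `sup|v|`.  For potentials with a SIGN the window is unnecessary:
* §1 (generic, any finite index set; the symmetric-form identity is the tree's `Beta.PlaquetteHessian.dotProduct_mulVec_comm_of_transpose`) ★ **`form_inv_antitone`** — for symmetric coercive `S` and invertible `T` with `S ≤ T` as quadratic forms,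
  `⟨x, T⁻¹x⟩ ≤ ⟨x, S⁻¹x⟩` (operator antitonicity of the inverse, proved by completing the square: `2⟨x,y⟩ − ⟨y,Sy⟩ = ⟨x,S⁻¹x⟩ − ⟨y − S⁻¹x, S(y − S⁻¹x)⟩`
  at `y = T⁻¹x`; no square roots).
* §2 ★ **`effLaplacianPot_dot`** (`⟨φ, Δ_eff(w)φ⟩ = a|φ|² − a²N^d⟨Qᵀφ, (A₀+w)⁻¹Qᵀφ⟩`) and ★★ **`effLaplacianPot_form_mono`**: for `a, m² ≥ 0` and potentials
  `−w₀ ≤ w ≤ w′` with `w₀ < γ_A`, `⟨φ, Δ_eff(w)φ⟩ ≤ ⟨φ, Δ_eff(w′)φ⟩` — the block-spin effective Laplacian is MONOTONE in the potential (a larger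
  potential on the fine lattice gives a stiffer effective quadratic form on the unit lattice; King's Gaussian-minimum formula `⟨φ,Δ^{(k)}φ⟩ = min_ψ E_φ(ψ)`
  makes this evident, here it is the antitonicity of `(A₀ + w)⁻¹`).
* §3 ★★ **`uniformCoercive_kingTowerPot_of_nonneg`** — along King's run, for EVERY potential tower `v ≥ 0` (no size restriction at all),
  `UniformCoercive (kingTowerPot v) (aL⁻²Q*Q) γ₀` with part 3's constant `γ₀ = gam0L` UNCHANGED (King's (4.33) survives any nonnegative dressing);
  `kingTowerPot_form_mono` (monotonicity of the dressed tower in the potential tower, levelwise).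

HONEST FRAMING ∕ LIMITS.  King's `A = 0` SCALAR block-spin construction; a potential is NOT a gauge field (for Bałaban's covariant `Δ^{(k)}(U)` there is no
such order structure — this is a feature of the scalar-potential model only); quadratic-form statements (no entrywise monotonicity is claimed); nothing
is Bałaban's `C^{(k)}(Λ;U)`; NOT a node discharge; typed 28∕28, discharged count untouched; one finite torus at fixed ε — NOT ℝ⁴ ∕ OS ∕ mass gap ∕ Clay.
Locators: [King1986] CMP **102** (1986): (2.4)–(2.6) p. 652, (2.13)–(2.14) p. 653 (the Gaussian minimum), (4.33) p. 674 (coercivity).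
-/

noncomputable section

open scoped BigOperators Matrix
open Finset

namespace Summit.QuantumFields.YangMills.BalabanUVNodes.N15.KingModel

open Literature.MathematicalPhysics.QuantumFieldTheory.Balaban1983to89 hiding blockOf
open Literature.MathematicalPhysics.QuantumFieldTheory.Balaban1983to89.QGQInverse (Coercive isUnit_of_coercive)
open Literature.MathematicalPhysics.QuantumFieldTheory.Balaban1983to89.B5Prop11Plancherel (Tor fine)
open Literature.MathematicalPhysics.QuantumFieldTheory.King1986 (aK aK_pos)
open Literature.MathematicalPhysics.QuantumFieldTheory.King1986.Torus
open Summit.QuantumFields.BalabanUV.T4Continuum.NE2KingTransplant (UniformCoercive)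

variable {d : ℕ}

/-! ## §1 Operator antitonicity of the inverse, in quadratic-form language -/

section Antitone

variable {n : Type} [Fintype n] [DecidableEq n]

/-- **COMPLETING THE SQUARE**: for symmetric invertible `S` and `z = S⁻¹x`, `2⟨x,y⟩ − ⟨y,Sy⟩ = ⟨x,S⁻¹x⟩ − ⟨y − z, S(y − z)⟩`. [folklore] -/
theorem two_dot_sub_form_eq {S : Matrix n n ℝ} (hS : Sᵀ = S) (hU : IsUnit S) (x y : n → ℝ) :
    2 * (x ⬝ᵥ y) - y ⬝ᵥ (S *ᵥ y) = x ⬝ᵥ (S⁻¹ *ᵥ x) - (y - S⁻¹ *ᵥ x) ⬝ᵥ (S *ᵥ (y - S⁻¹ *ᵥ x)) := by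
  set z := S⁻¹ *ᵥ x with hz
  have hdet : IsUnit S.det := (Matrix.isUnit_iff_isUnit_det S).mp hU
  have hSz : S *ᵥ z = x := by rw [hz, Matrix.mulVec_mulVec, Matrix.mul_nonsing_inv S hdet, Matrix.one_mulVec]
  have h1 : z ⬝ᵥ (S *ᵥ y) = y ⬝ᵥ x := by rw [Beta.PlaquetteHessian.dotProduct_mulVec_comm_of_transpose hS z y, hSz]
  have h2 : y ⬝ᵥ x = x ⬝ᵥ y := dotProduct_comm y x
  rw [Matrix.mulVec_sub, sub_dotProduct, dotProduct_sub, dotProduct_sub, hSz, h1, h2, dotProduct_comm z x]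
  ring

/-- **OPERATOR ANTITONICITY OF THE INVERSE, AS QUADRATIC FORMS**: `S` symmetric and coercive (`γ > 0`), `T` invertible, `⟨y,Sy⟩ ≤ ⟨y,Ty⟩` for all `y`
⇒ `⟨x, T⁻¹x⟩ ≤ ⟨x, S⁻¹x⟩` for all `x`.  (Take `y = T⁻¹x`: `⟨x,T⁻¹x⟩ = 2⟨x,y⟩ − ⟨y,Ty⟩ ≤ 2⟨x,y⟩ − ⟨y,Sy⟩ ≤ ⟨x,S⁻¹x⟩` by completing the square.) [folklore] -/
theorem form_inv_antitone {S T : Matrix n n ℝ} (hS : Sᵀ = S) {γ : ℝ} (hγ : 0 < γ) (hSc : Coercive S γ) (hT : IsUnit T)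
    (hle : ∀ y : n → ℝ, y ⬝ᵥ (S *ᵥ y) ≤ y ⬝ᵥ (T *ᵥ y)) (x : n → ℝ) : x ⬝ᵥ (T⁻¹ *ᵥ x) ≤ x ⬝ᵥ (S⁻¹ *ᵥ x) := by
  set y := T⁻¹ *ᵥ x with hy
  have hTdet : IsUnit T.det := (Matrix.isUnit_iff_isUnit_det T).mp hT
  have hTy : T *ᵥ y = x := by rw [hy, Matrix.mulVec_mulVec, Matrix.mul_nonsing_inv T hTdet, Matrix.one_mulVec]
  have h0 : x ⬝ᵥ y = 2 * (x ⬝ᵥ y) - y ⬝ᵥ (T *ᵥ y) := by rw [hTy, dotProduct_comm y x]; ring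
  have hU : IsUnit S := isUnit_of_coercive hγ hSc
  have hsq := two_dot_sub_form_eq hS hU x y
  have hpos : 0 ≤ (y - S⁻¹ *ᵥ x) ⬝ᵥ (S *ᵥ (y - S⁻¹ *ᵥ x)) :=
    le_trans (mul_nonneg hγ.le (Literature.LinearAlgebra.Matrix.dotProduct_self_nonneg_real _)) (hSc _)
  calc x ⬝ᵥ (T⁻¹ *ᵥ x) = x ⬝ᵥ y := rfl
    _ = 2 * (x ⬝ᵥ y) - y ⬝ᵥ (T *ᵥ y) := h0
    _ ≤ 2 * (x ⬝ᵥ y) - y ⬝ᵥ (S *ᵥ y) := by linarith [hle y]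
    _ = x ⬝ᵥ (S⁻¹ *ᵥ x) - (y - S⁻¹ *ᵥ x) ⬝ᵥ (S *ᵥ (y - S⁻¹ *ᵥ x)) := hsq
    _ ≤ x ⬝ᵥ (S⁻¹ *ᵥ x) := by linarith

end Antitone

/-! ## §2 The dressed effective Laplacian is monotone in the potential -/

section Monotone

variable {N : ℕ} [NeZero N] {U : Fin (d + 1) → ℕ} [∀ μ, NeZero (U μ)] {a m2 : ℝ}

/-- `⟨φ, Δ_eff(w)φ⟩ = a⟨φ,φ⟩ − a²N^{d+1}⟨Qᵀφ, (A₀+w)⁻¹Qᵀφ⟩` (the tree's `effLaplacian_dot` with the potential live). [cite: King1986, (2.14) p.653] -/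
theorem effLaplacianPot_dot (c : ℝ) (w : Tor (fine N U) → ℝ) (φ : Tor U → ℝ) :
    φ ⬝ᵥ (effLaplacianPot N U a c m2 w *ᵥ φ)
      = a * (φ ⬝ᵥ φ) - (a ^ 2 * (N : ℝ) ^ (d + 1))
        * (((Qmat N U)ᵀ *ᵥ φ) ⬝ᵥ ((fineOpPot N U a c m2 w)⁻¹ *ᵥ ((Qmat N U)ᵀ *ᵥ φ))) := by
  have hsand : φ ⬝ᵥ ((Qmat N U * (fineOpPot N U a c m2 w)⁻¹ * (Qmat N U)ᵀ) *ᵥ φ)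
      = ((Qmat N U)ᵀ *ᵥ φ) ⬝ᵥ ((fineOpPot N U a c m2 w)⁻¹ *ᵥ ((Qmat N U)ᵀ *ᵥ φ)) := by
    rw [← Matrix.mulVec_mulVec, ← Matrix.mulVec_mulVec, Matrix.dotProduct_mulVec, ← Matrix.mulVec_transpose]
  rw [effLaplacianPot, Matrix.sub_mulVec, dotProduct_sub, Matrix.smul_mulVec, dotProduct_smul, Matrix.one_mulVec, Matrix.smul_mulVec,
    dotProduct_smul, hsand, smul_eq_mul, smul_eq_mul]

/-- The fine quadratic form is monotone in the potential: `w ≤ w′ ⇒ ⟨ψ,(A₀+w)ψ⟩ ≤ ⟨ψ,(A₀+w′)ψ⟩`. [folklore] -/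
theorem fineOpPot_form_mono (c : ℝ) {w w' : Tor (fine N U) → ℝ} (hle : ∀ x, w x ≤ w' x) (ψ : Tor (fine N U) → ℝ) :
    ψ ⬝ᵥ (fineOpPot N U a c m2 w *ᵥ ψ) ≤ ψ ⬝ᵥ (fineOpPot N U a c m2 w' *ᵥ ψ) := by
  rw [fineOpPot, fineOpPot, Matrix.add_mulVec, Matrix.add_mulVec, dotProduct_add, dotProduct_add]
  have hd : ∀ u : Tor (fine N U) → ℝ, ψ ⬝ᵥ (Matrix.diagonal u *ᵥ ψ) = ∑ i, u i * (ψ i * ψ i) := fun u => by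
    unfold dotProduct; exact sum_congr rfl fun i _ => by rw [Matrix.mulVec_diagonal]; ring
  rw [hd, hd]
  have : ∑ i, w i * (ψ i * ψ i) ≤ ∑ i, w' i * (ψ i * ψ i) :=
    sum_le_sum fun i _ => mul_le_mul_of_nonneg_right (hle i) (mul_self_nonneg _)
  linarith

/-- The transpose of the dressed fine operator. [folklore] -/
theorem fineOpPot_transpose (c : ℝ) (w : Tor (fine N U) → ℝ) : (fineOpPot N U a c m2 w)ᵀ = fineOpPot N U a c m2 w := by
  ext i j; rw [Matrix.transpose_apply]; exact fineOpPot_symm c w i j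

/-- **THE DRESSED EFFECTIVE LAPLACIAN IS MONOTONE IN THE POTENTIAL**: for `a, m² ≥ 0` and potentials `−w₀ ≤ w ≤ w′` with `w₀ < γ_A` (so both dressed fine
operators are coercive), `⟨φ, Δ_eff(w)φ⟩ ≤ ⟨φ, Δ_eff(w′)φ⟩` for every `φ` — a larger potential on the fine lattice yields a stiffer effective quadratic form
on the unit lattice (antitonicity of `(A₀ + w)⁻¹`). [cite: King1986, (2.4)–(2.6) p.652, (2.13)–(2.14) p.653 (the Gaussian minimum, A = 0)] -/
theorem effLaplacianPot_form_mono (ha : 0 ≤ a) (hm : 0 ≤ m2) {w w' : Tor (fine N U) → ℝ} {w₀ : ℝ} (hw : ∀ x, -w₀ ≤ w x)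
    (hw₀ : w₀ < gamA a (d + 1)) (hle : ∀ x, w x ≤ w' x) (φ : Tor U → ℝ) :
    φ ⬝ᵥ (effLaplacianPot N U a ((N : ℝ) ^ 2) m2 w *ᵥ φ) ≤ φ ⬝ᵥ (effLaplacianPot N U a ((N : ℝ) ^ 2) m2 w' *ᵥ φ) := by
  have hw' : ∀ x, -w₀ ≤ w' x := fun x => (hw x).trans (hle x)
  have hγ : 0 < gamA a (d + 1) - w₀ := sub_pos.mpr hw₀
  have hanti := form_inv_antitone (fineOpPot_transpose ((N : ℝ) ^ 2) w) hγ (fineOpPot_coercive_of_ge ha hm hw)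
    (fineOpPot_isUnit ha hm hw' hw₀) (fineOpPot_form_mono ((N : ℝ) ^ 2) hle) ((Qmat N U)ᵀ *ᵥ φ)
  rw [effLaplacianPot_dot, effLaplacianPot_dot]
  have hc : 0 ≤ a ^ 2 * (N : ℝ) ^ (d + 1) := by positivity
  nlinarith [mul_le_mul_of_nonneg_left hanti hc]

end Monotone

/-! ## §3 King by name: a nonnegative potential tower of any size keeps King's coercivity `γ₀` -/

section King

variable {a m2 : ℝ} {L : ℕ} [NeZero L] {M : Fin (d + 1) → ℕ} [∀ μ, NeZero (M μ)]

/-- **THE FULLY DRESSED TOWER IS MONOTONE IN THE POTENTIAL TOWER, LEVELWISE**: for `L ≥ 2`, `a, m² > 0` and towers `−w₀ ≤ v ≤ v′` with `w₀ < γ_A(a_min)`,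
`⟨φ, Δ^{(max j 1)}_{v}φ⟩ ≤ ⟨φ, Δ^{(max j 1)}_{v′}φ⟩` at every level. [cite: King1986, (2.13)–(2.14) p.653] -/
theorem kingTowerPot_form_mono (ha : 0 < a) (hm : 0 < m2) (hL : 2 ≤ L) {v v' : ∀ N : ℕ, Tor (fine N (fine L M)) → ℝ} {w₀ : ℝ}
    (hv : ∀ N x, -w₀ ≤ v N x) (hw₀ : w₀ < gamA (aminL a L) (d + 1)) (hle : ∀ N x, v N x ≤ v' N x) (j : ℕ) (φ : Tor (fine L M) → ℝ) :
    φ ⬝ᵥ (kingTowerPot a m2 L M v j *ᵥ φ) ≤ φ ⬝ᵥ (kingTowerPot a m2 L M v' j *ᵥ φ) := by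
  have hj : 1 ≤ max j 1 := le_max_right j 1
  obtain ⟨hk1, -⟩ := aminL_le_aK ha hL hj
  have hak : 0 < aK a L (max j 1) := aK_pos ha (one_lt_cast_of_two_le hL) hj
  have hγ : w₀ < gamA (aK a L (max j 1)) (d + 1) := lt_of_lt_of_le hw₀ (gamA_mono hk1 (d + 1))
  exact effLaplacianPot_form_mono (N := L ^ max j 1) (U := fine L M) (m2 := m2) hak.le hm.le (hv (L ^ max j 1)) hγ (hle (L ^ max j 1)) φ

/-- **A NONNEGATIVE POTENTIAL TOWER OF ANY SIZE KEEPS KING'S COERCIVITY (4.33)**: for `L ≥ 2`, `a, m² > 0` and EVERY potential tower `v ≥ 0`,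
`UniformCoercive (kingTowerPot v) (aL⁻²Q*Q) γ₀` with part 3's `γ₀ = gam0L` UNCHANGED — no smallness window (contrast 9c's `uniformCoercive_kingTowerPot`,
which pays `c_E·V` for a signed potential). [cite: King1986, (4.33) p.674 (A = 0; here with a nonnegative potential live)] -/
theorem uniformCoercive_kingTowerPot_of_nonneg (ha : 0 < a) (hm : 0 < m2) (hL : 2 ≤ L) {v : ∀ N : ℕ, Tor (fine N (fine L M)) → ℝ}
    (hv : ∀ N x, 0 ≤ v N x) : UniformCoercive (kingTowerPot a m2 L M v) (kingBlock a L M) (gam0L (d + 1) a L) := by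
  intro j φ
  have h0 := uniformCoercive_kingTower (dd := d + 1) ha hm hL (M := M) j φ
  have hmono := kingTowerPot_form_mono (M := M) (v := fun _ _ => (0 : ℝ)) (v' := v) (w₀ := 0) ha hm hL (fun N x => by norm_num)
    (gamA_pos (aminL_pos ha hL) (d + 1)) (fun N x => hv N x) j φ
  have e0 : kingTowerPot a m2 L M (fun _ _ => 0) j = kingTower a m2 L M j := by
    show kingLevelPot a m2 L M (max j 1) (fun _ => 0) = kingTower a m2 L M j
    rw [kingLevelPot_zero]; rfl
  rw [e0] at hmono
  rw [Matrix.add_mulVec, dotProduct_add] at h0 ⊢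
  linarith

end King

end Summit.QuantumFields.YangMills.BalabanUVNodes.N15.KingModel

end
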